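import Summits.KontsevichZagierPeriods.KontsevichZagierPeriods.Theorems.TerasomaMultiplicationBetaCancellationEulerAngles
import Summits.KontsevichZagierPeriods.KontsevichZagierPeriods.Theorems.TerasomaMultiplicationBetaCancellationStubAffineMove
import Summits.KontsevichZagierPeriods.KontsevichZagierPeriods.Theorems.TerasomaMultiplicationBetaCancellationStubEulerPartialFractions
import Summits.KontsevichZagierPeriods.KontsevichZagierPeriods.Theorems.TerasomaMultiplicationBetaCancellationStubEulerTrigSum

/-!
# Euler reflection inside the calculus (item stmt-KontsevichZagierPeriods-3383) — the two sides down to the fundamental piece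

Lead's glue, part 3: `piSide_reduce` (`[(-1,1), 2/(1+t²)]` is `q` fundamental pieces),
`term_reduce` (one partial-fraction term is `q−2j−1` pieces, via `stub_affineMove` and
`arctan_reduce`), the term representations, and `eulerSide_reduce`
(`[(0,1), sin(πp/q)·q(x^{p-1}+x^{q-p-1})/(1+x^q)] − [(0,tan(π/2q)), 2q/(1+t²)] ∈ relations`,
using `stub_eulerPartialFractions` and `stub_eulerTrigSum`).
-/

noncomputable section

-- `Summit.KontsevichZagierPeriods.KontsevichZagierPeriods.…` is the tree's mandated layout (single-conjunct summit).
set_option linter.dupNamespace false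

namespace Summit.KontsevichZagierPeriods.KontsevichZagierPeriods.BetaCancellationLine

open MeasureTheory Set
open Literature.NumberTheory.Transcendental
open Literature.NumberTheory.Transcendental.KZ
open Literature.ModelTheory.ExponentialFields (IsSemialgebraic isSemialgebraic_univ)
open MvPolynomial (aeval X C)
open Summit.KontsevichZagierPeriods.KontsevichZagierPeriods.BetaCancellationNegative

/-! ## The `π` side: `[(-1,1), 2/(1+t²)]` is `q` copies of the fundamental piece -/

/-- `tan (ang q (−q)) = −1`. [folklore] -/
theorem tan_ang_neg_self {q : ℕ} (hq : 0 < q) : Real.tan (ang q (-(q:ℤ))) = -1 := by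
  have hq' : (q:ℝ) ≠ 0 := by exact_mod_cast hq.ne'
  have : ang q (-(q:ℤ)) = -(Real.pi / 4) := by
    simp only [ang, Int.cast_neg, Int.cast_natCast]; field_simp
  rw [this, Real.tan_neg, Real.tan_pi_div_four]

/-- `tan (ang q (−q + 2q)) = 1`. [folklore] -/
theorem tan_ang_neg_self_add {q : ℕ} (hq : 0 < q) : Real.tan (ang q (-(q:ℤ) + 2 * (q : ℕ))) = 1 := by
  have hq' : (q:ℝ) ≠ 0 := by exact_mod_cast hq.ne'
  have : ang q (-(q:ℤ) + 2 * (q : ℕ)) = Real.pi / 4 := by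
    simp only [ang, Int.cast_add, Int.cast_neg, Int.cast_mul, Int.cast_ofNat, Int.cast_natCast]
    field_simp; ring
  rw [this, Real.tan_pi_div_four]

/-- **The `π` side**: `[(-1,1), 2/(1+t²)] − q·[(0, tan(π/2q)), 2/(1+t²)] ∈ relations`. [folklore] -/
theorem piSide_reduce {q : ℕ} (hq : 0 < q) (hq1 : 1 < q) (W Z : IntegralRep 1)
    (hW : W.domain = Ioo1 (-1) 1) (hWi : Set.EqOn W.integrand (fun x => 2 / (1 + (x 0) ^ 2)) W.domain)
    (hZ : Z.domain = Ioo1 0 (Real.tan (Real.pi / (2 * q))))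
    (hZi : Set.EqOn Z.integrand (fun x => 2 / (1 + (x 0) ^ 2)) Z.domain) :
    of W - q • of Z ∈ relations := by
  refine arctan_reduce hq hq1 (κ := 2) (isAlgebraic_nat 2 |> fun h => by exact_mod_cast h) (-(q:ℤ)) q
    (by omega) (by omega) W Z ?_ hWi hZ hZi
  rw [hW, tan_ang_neg_self hq, tan_ang_neg_self_add hq]

/-! ## The Euler terms: `[(0,1), κ_j sin θ_j/(x² − 2x cos θ_j + 1)]` is `(q−2j−1)` fundamental pieces -/

/-- The angle `θ_j = (2j+1)π/q` in the `ang` spelling: `θ_j − π/2 = ang q (4(2j+1) − 2q)`. [folklore] -/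
theorem theta_sub_eq_ang {q : ℕ} (hq : 0 < q) (j : ℕ) :
    Real.pi * (2 * j + 1) / q - Real.pi / 2 = ang q (4 * (2 * j + 1) - 2 * q) := by
  have hq' : (q:ℝ) ≠ 0 := by exact_mod_cast hq.ne'
  simp only [ang, Int.cast_sub, Int.cast_mul, Int.cast_ofNat, Int.cast_add, Int.cast_one,
    Int.cast_natCast]
  field_simp
  ring

/-- `θ_j/2 = ang q (4(2j+1) − 2q + 2(q−2j−1))` when `2j+1 < q`. [folklore] -/
theorem theta_half_eq_ang {q : ℕ} (hq : 0 < q) (j : ℕ) (hj : 2 * j + 1 < q) :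
    Real.pi * (2 * j + 1) / q / 2 = ang q (4 * (2 * j + 1) - 2 * q + 2 * ((q - 2 * j - 1 : ℕ) : ℕ)) := by
  have hq' : (q:ℝ) ≠ 0 := by exact_mod_cast hq.ne'
  have hcast : (((q - 2 * j - 1 : ℕ) : ℕ) : ℤ) = (q:ℤ) - 2 * j - 1 := by omega
  simp only [ang, hcast, Int.cast_add, Int.cast_sub, Int.cast_mul, Int.cast_ofNat, Int.cast_one,
    Int.cast_natCast]
  field_simp
  ring

/-- `0 < θ_j < π` for `2j + 1 < q`. [folklore] -/
theorem theta_mem_Ioo {q : ℕ} (hq : 0 < q) (j : ℕ) (hj : 2 * j + 1 < q) :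
    Real.pi * (2 * j + 1) / q ∈ Set.Ioo 0 Real.pi := by
  have hq' : (0:ℝ) < q := by exact_mod_cast hq
  have hj' : (2 * j + 1 : ℝ) < q := by exact_mod_cast hj
  constructor
  · positivity
  · rw [div_lt_iff₀ hq']
    nlinarith [Real.pi_pos]

/-- **Reduction of one Euler term**: for `2j+1 < q`, κ algebraic and the angle `θ = (2j+1)π/q`,
`[(0,1), κ sin θ/(x² − 2x cos θ + 1)] − (q−2j−1)·[(0,tan(π/2q)), κ/(1+t²)] ∈ relations`
(affine move onto `((0−cos θ)/sin θ, (1−cos θ)/sin θ) = (tan(θ−π/2), tan(θ/2))`, then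
`arctan_reduce`). [folklore] -/
theorem term_reduce {q : ℕ} (hq : 0 < q) (hq1 : 1 < q) (j : ℕ) (hj : 2 * j + 1 < q) {κ : ℝ}
    (hκ : IsAlgebraic ℚ κ) (T Z : IntegralRep 1) (hT : T.domain = Ioo1 0 1)
    (hTi : Set.EqOn T.integrand (fun x => κ * Real.sin (Real.pi * (2 * j + 1) / q) /
      ((x 0) ^ 2 - 2 * Real.cos (Real.pi * (2 * j + 1) / q) * (x 0) + 1)) T.domain)
    (hZ : Z.domain = Ioo1 0 (Real.tan (Real.pi / (2 * q))))
    (hZi : Set.EqOn Z.integrand (fun x => κ / (1 + (x 0) ^ 2)) Z.domain) :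
    of T - (q - 2 * j - 1 : ℕ) • of Z ∈ relations := by
  set θ := Real.pi * (2 * j + 1) / q with hθ
  set k₀ : ℤ := 4 * (2 * j + 1) - 2 * q with hk₀
  set N : ℕ := q - 2 * j - 1 with hN
  have hθmem := theta_mem_Ioo hq j hj
  have hs0 : 0 < Real.sin θ := Real.sin_pos_of_pos_of_lt_pi hθmem.1 hθmem.2
  have hhalf : θ / 2 ∈ Set.Ioo 0 (Real.pi / 2) := ⟨by linarith [hθmem.1], by linarith [hθmem.2]⟩
  have hsh : Real.sin (θ / 2) ≠ 0 :=
    (Real.sin_pos_of_pos_of_lt_pi hhalf.1 (by linarith [hhalf.2, Real.pi_pos])).ne'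
  have hch : Real.cos (θ / 2) ≠ 0 :=
    (Real.cos_pos_of_mem_Ioo ⟨by linarith [hhalf.1, Real.pi_pos], hhalf.2⟩).ne'
  -- θ as a rational multiple of π: algebraic cos/sin
  have hθcast : θ = Real.pi * ((2 * j + 1 : ℕ) : ℕ) / q := by simp [hθ]
  have hcalg : IsAlgebraic ℚ (Real.cos θ) := by
    rw [hθcast]; exact KoblitzOgus.isAlgebraic_cos_rat_mul_pi _ hq
  have hsalg : IsAlgebraic ℚ (Real.sin θ) := by
    rw [hθcast]; exact KoblitzOgus.isAlgebraic_sin_rat_mul_pi _ hq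
  have hcs : Real.cos θ ^ 2 + Real.sin θ ^ 2 = 1 := by rw [add_comm]; exact Real.sin_sq_add_cos_sq θ
  -- the end points of the `m`-interval are `tan (ang q k₀)` and `tan (ang q (k₀ + 2N))`
  have hu : (0 - Real.cos θ) / Real.sin θ = Real.tan (ang q k₀) := by
    rw [neg_cos_div_sin_eq_tan, hθ, theta_sub_eq_ang hq j]
  have hv : (1 - Real.cos θ) / Real.sin θ = Real.tan (ang q (k₀ + 2 * N)) := by
    rw [one_sub_cos_div_sin_eq_tan_half hsh hch, hθ, theta_half_eq_ang hq j hj]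
  -- the arctan representation on that interval
  set A := arctanRep (Real.tan (ang q k₀)) (Real.tan (ang q (k₀ + 2 * N))) κ
    (isAlgebraic_tan_ang hq _) (isAlgebraic_tan_ang hq _) hκ with hA
  have hTA : Equivalent T A := by
    refine stub_affineMove (Real.cos θ) (Real.sin θ) κ hcalg hsalg hκ hs0 hcs T A hT (fun x hx => ?_)
      ?_ (fun x _ => rfl)
    · exact hTi hx
    · rw [hA, arctanRep_domain, hu, hv]; rfl
  have hAZ : of A - N • of Z ∈ relations :=
    arctan_reduce hq hq1 hκ k₀ N (by omega) (by omega) A Z rfl (fun x _ => rfl) hZ hZi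
  have := relations.add_mem hTA hAZ
  simpa [Equivalent] using this


/-! ## The term representations `[(0,1), κ sin θ/(x² − 2x cos θ + 1)]` -/

/-- The closed unit box of `ℝ¹` is compact. [folklore] -/
theorem isCompact_unitIcc1 : IsCompact {x : Fin 1 → ℝ | x 0 ∈ Set.Icc (0:ℝ) 1} := by
  have h : {x : Fin 1 → ℝ | x 0 ∈ Set.Icc (0:ℝ) 1} = Set.pi univ fun _ : Fin 1 => Set.Icc (0:ℝ) 1 := by
    ext x
    simp only [Set.mem_setOf_eq, Set.mem_pi, Set.mem_univ, true_implies, Fin.forall_fin_one]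
  rw [h]
  exact isCompact_univ_pi fun _ => isCompact_Icc

/-- A function continuous on the closed unit box is integrable on `(0,1) ⊆ ℝ¹`. [folklore] -/
theorem integrableOn_Ioo1_of_continuousOn {f : (Fin 1 → ℝ) → ℝ}
    (hf : ContinuousOn f {x : Fin 1 → ℝ | x 0 ∈ Set.Icc (0:ℝ) 1}) : IntegrableOn f (Ioo1 0 1) :=
  (hf.integrableOn_compact isCompact_unitIcc1).mono_set fun _ hx => ⟨hx.1.le, hx.2.le⟩

/-- **The term representation** `[(0,1), κ sin θ/(x² − 2x cos θ + 1)]` for a rational multiple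
`θ = πm/q` of `π` with `sin θ ≠ 0` and algebraic `κ`. [folklore] -/
def termRep (κ : ℝ) (hκ : IsAlgebraic ℚ κ) (m q : ℕ) (hq : 0 < q) (hs : Real.sin (Real.pi * m / q) ≠ 0) :
    IntegralRep 1 :=
  intervalRep 0 1 (by simpa using isAlgebraic_nat 0) (by simpa using isAlgebraic_nat 1)
    (fun t => κ * Real.sin (Real.pi * m / q) / (t ^ 2 - 2 * Real.cos (Real.pi * m / q) * t + 1))
    (by
      have hσ : IsSemialgebraic ℚ (Ioo1 0 1) := isSemialgebraic_Ioo1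
        (by simpa using isAlgebraic_nat 0) (by simpa using isAlgebraic_nat 1)
      have hden : IsSemialgebraicFunOn ℚ (Ioo1 0 1)
          (fun x : Fin 1 → ℝ => (x 0) ^ 2 - 2 * Real.cos (Real.pi * m / q) * (x 0) + 1) := by
        have h1 : IsSemialgebraicFunOn ℚ (Ioo1 0 1) (fun x : Fin 1 → ℝ => (x 0) ^ 2 + 1) :=
          (isSemialgebraicFunOn_aeval hσ (X 0 ^ 2 + 1)).congr fun x _ => by simp
        have hcoord : IsSemialgebraicFunOn ℚ (Ioo1 0 1) (fun x : Fin 1 → ℝ => x 0) :=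
          (isSemialgebraicFunOn_aeval hσ (X 0)).congr fun x _ => by simp
        have h2 : IsSemialgebraicFunOn ℚ (Ioo1 0 1) (fun x : Fin 1 → ℝ => (2 * Real.cos (Real.pi * m / q)) * x 0) :=
          (IsSemialgebraicFunOn.mul_holds (isSemialgebraicFunOn_const_of_isAlgebraic hσ
            (c := 2 * Real.cos (Real.pi * m / q)) (by
              have h := (isAlgebraic_nat 2).mul (KoblitzOgus.isAlgebraic_cos_rat_mul_pi m hq)
              exact_mod_cast h)) hcoord).congr fun x _ => by simp only [Pi.mul_apply]
        exact (IsSemialgebraicFunOn.sub_holds h1 h2).congr fun x _ => by simp only [Pi.sub_apply]; ring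
      have hpos : ∀ x ∈ Ioo1 0 1, (x 0) ^ 2 - 2 * Real.cos (Real.pi * m / q) * (x 0) + 1 ≠ 0 := by
        intro x _
        have := Real.sin_sq_add_cos_sq (Real.pi * m / q)
        have hs2 : 0 < Real.sin (Real.pi * m / q) ^ 2 := by positivity
        nlinarith [sq_nonneg (x 0 - Real.cos (Real.pi * m / q))]
      exact IsSemialgebraicFunOn.div (isSemialgebraicFunOn_const_of_isAlgebraic hσ
        (hκ.mul (KoblitzOgus.isAlgebraic_sin_rat_mul_pi m hq))) hden hpos)
    (by
      have hc : Continuous fun t : ℝ => κ * Real.sin (Real.pi * m / q) /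
          (t ^ 2 - 2 * Real.cos (Real.pi * m / q) * t + 1) := by
        refine Continuous.div continuous_const (by fun_prop) fun t => ?_
        have := Real.sin_sq_add_cos_sq (Real.pi * m / q)
        have hs2 : 0 < Real.sin (Real.pi * m / q) ^ 2 := by positivity
        nlinarith [sq_nonneg (t - Real.cos (Real.pi * m / q))]
      exact (hc.integrableOn_Icc (a := 0) (b := 1)).mono_set Ioo_subset_Icc_self)

/-- The domain of `termRep`. [folklore] -/
@[simp] theorem termRep_domain (κ : ℝ) (hκ : IsAlgebraic ℚ κ) (m q : ℕ) (hq : 0 < q)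
    (hs : Real.sin (Real.pi * m / q) ≠ 0) : (termRep κ hκ m q hq hs).domain = Ioo1 0 1 := rfl

/-- The integrand of `termRep`. [folklore] -/
@[simp] theorem termRep_integrand (κ : ℝ) (hκ : IsAlgebraic ℚ κ) (m q : ℕ) (hq : 0 < q)
    (hs : Real.sin (Real.pi * m / q) ≠ 0) : (termRep κ hκ m q hq hs).integrand =
      fun x => κ * Real.sin (Real.pi * m / q) / ((x 0) ^ 2 - 2 * Real.cos (Real.pi * m / q) * (x 0) + 1) := rfl

/-! ## From the rational integrand to the fundamental piece -/

/-- **The Euler side**: if `Fc = [(0,1), c·q(x^{p-1}+x^{q-p-1})/(1+x^q)]` with `c = sin(πp/q)`, then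
`[Fc] − [(0, tan(π/2q)), 2q/(1+t²)] ∈ relations` (partial fractions, term reductions, the
trigonometric sum). [folklore] -/
theorem eulerSide_reduce {p q : ℕ} (hp : 0 < p) (hpq : p < q) (Fc Ztot : IntegralRep 1)
    (hFc : Fc.domain = Ioo1 0 1)
    (hFci : Set.EqOn Fc.integrand (fun x => Real.sin (Real.pi * p / q) *
      ((q:ℝ) * ((x 0) ^ (p - 1) + (x 0) ^ (q - p - 1)) / (1 + (x 0) ^ q))) Fc.domain)
    (hZ : Ztot.domain = Ioo1 0 (Real.tan (Real.pi / (2 * q))))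
    (hZi : Set.EqOn Ztot.integrand (fun x => (2 * q : ℝ) / (1 + (x 0) ^ 2)) Ztot.domain) :
    of Fc - of Ztot ∈ relations := by
  classical
  have hq : 0 < q := lt_of_le_of_lt (Nat.zero_le _) hpq
  have hq1 : 1 < q := by omega
  set c := Real.sin (Real.pi * p / q) with hc
  have hcalg : IsAlgebraic ℚ c := KoblitzOgus.isAlgebraic_sin_rat_mul_pi p hq
  -- the weights `κ_j = 4 c sin(p θ_j)`
  set κ : ℕ → ℝ := fun j => 4 * c * Real.sin (Real.pi * (2 * j + 1) * p / q) with hκ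
  have hκalg : ∀ j, IsAlgebraic ℚ (κ j) := by
    intro j
    have h := KoblitzOgus.isAlgebraic_sin_rat_mul_pi ((2 * j + 1) * p) hq
    have he : Real.pi * (((2 * j + 1) * p : ℕ) : ℝ) / q = Real.pi * (2 * j + 1) * p / q := by
      push_cast; ring
    rw [he] at h
    exact ((isAlgebraic_nat 4).mul hcalg).mul h
  have hsj : ∀ j, 2 * j + 1 < q → Real.sin (Real.pi * ((2 * j + 1 : ℕ) : ℕ) / q) ≠ 0 := by
    intro j hj
    have hm := theta_mem_Ioo hq j hj
    have : Real.pi * (((2 * j + 1 : ℕ) : ℕ) : ℝ) / q = Real.pi * (2 * j + 1) / q := by push_cast; ring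
    rw [this]
    exact (Real.sin_pos_of_pos_of_lt_pi hm.1 hm.2).ne'
  have hjq : ∀ j ∈ Finset.range (q / 2), 2 * j + 1 < q := by
    intro j hj
    have := Finset.mem_range.1 hj
    omega
  -- the term representations
  let T : ℕ → IntegralRep 1 := fun j =>
    if hj : 2 * j + 1 < q then termRep (κ j) (hκalg j) (2 * j + 1) q hq (hsj j hj) else Fc
  have hTd : ∀ j, 2 * j + 1 < q → (T j).domain = Ioo1 0 1 := by intro j hj; simp [T, hj]
  have hTi : ∀ j, 2 * j + 1 < q → (T j).integrand = fun x => κ j * Real.sin (Real.pi * (2 * j + 1) / q) /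
      ((x 0) ^ 2 - 2 * Real.cos (Real.pi * (2 * j + 1) / q) * (x 0) + 1) := by
    intro j hj
    simp only [T, hj, dite_true, termRep_integrand]
    push_cast
    rfl
  -- (1) partial fractions: `[Fc] − Σ_j [T j] ∈ relations`
  have h1 : of Fc - ∑ j ∈ Finset.range (q / 2), of (T j) ∈ relations := by
    refine of_sub_sum_of_mem_relations (Finset.range (q / 2)) Fc T (fun j hj => by rw [hTd j (hjq j hj), hFc])
      fun x hx => ?_
    rw [hFci hx]
    have hx' : x ∈ Ioo1 0 1 := by rwa [hFc] at hx
    have hpos : (0:ℝ) < 1 + (x 0) ^ q := by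
      have := pow_pos hx'.1 q; linarith
    have key := stub_eulerPartialFractions p q hp hpq (x 0)
    have : (q:ℝ) * ((x 0) ^ (p - 1) + (x 0) ^ (q - p - 1)) / (1 + (x 0) ^ q) =
        ∑ j ∈ Finset.range (q / 2), 4 * Real.sin (Real.pi * (2 * j + 1) * p / q) *
          Real.sin (Real.pi * (2 * j + 1) / q) / ((x 0) ^ 2 - 2 * Real.cos (Real.pi * (2 * j + 1) / q) * (x 0) + 1) := by
      rw [div_eq_iff hpos.ne', key]; ring
    show c * ((q:ℝ) * ((x 0) ^ (p - 1) + (x 0) ^ (q - p - 1)) / (1 + (x 0) ^ q)) =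
      ∑ i ∈ Finset.range (q / 2), (T i).integrand x
    rw [this, Finset.mul_sum]
    refine Finset.sum_congr rfl fun j hj => ?_
    rw [hTi j (hjq j hj)]
    simp only [hκ]
    ring
  -- (2) each term is `(q−2j−1)` fundamental pieces
  set Zj : ℕ → IntegralRep 1 := fun j => arctanRep 0 (Real.tan (Real.pi / (2 * q))) (κ j)
    (by simpa using isAlgebraic_nat 0) (by rw [tan_step_eq hq]; exact isAlgebraic_tan_ang hq 2) (hκalg j) with hZj
  have h2 : ∀ j ∈ Finset.range (q / 2), of (T j) - (q - 2 * j - 1 : ℕ) • of (Zj j) ∈ relations := by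
    intro j hj
    exact term_reduce hq hq1 j (hjq j hj) (hκalg j) (T j) (Zj j) (hTd j (hjq j hj))
      (fun x _ => by rw [hTi j (hjq j hj)]) rfl (fun x _ => rfl)
  -- (3) integer multiples as scaled representations
  have h3 : ∀ j, (q - 2 * j - 1 : ℕ) • of (Zj j) -
      of ((Zj j).constMul ((q - 2 * j - 1 : ℕ) : ℝ) (isAlgebraic_nat _)) ∈ relations := by
    intro j
    have := relations.neg_mem (of_constMul_nat_sub_nsmul_mem (Zj j) (q - 2 * j - 1))
    simpa using this
  -- (4) collect on the fundamental interval: the trigonometric sum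
  have h4 : of Ztot - ∑ j ∈ Finset.range (q / 2),
      of ((Zj j).constMul ((q - 2 * j - 1 : ℕ) : ℝ) (isAlgebraic_nat _)) ∈ relations := by
    refine of_sub_sum_of_mem_relations (Finset.range (q / 2)) Ztot _ (fun j _ => by rw [hZ]; rfl)
      fun x hx => ?_
    rw [hZi hx]
    simp only [IntegralRep.integrand_constMul, hZj, arctanRep_integrand]
    have key := stub_eulerTrigSum p q hp hpq
    have hcast : ∀ j ∈ Finset.range (q / 2), (((q - 2 * j - 1 : ℕ) : ℕ) : ℝ) = (q:ℝ) - 2 * j - 1 := by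
      intro j hj
      have := hjq j hj
      rw [Nat.cast_sub (by omega), Nat.cast_sub (by omega)]
      push_cast
      ring
    have : ∑ j ∈ Finset.range (q / 2), (((q - 2 * j - 1 : ℕ) : ℕ) : ℝ) * (κ j / (1 + (x 0) ^ 2)) =
        (∑ j ∈ Finset.range (q / 2), ((q:ℝ) - 2 * j - 1) * κ j) / (1 + (x 0) ^ 2) := by
      rw [Finset.sum_div]
      refine Finset.sum_congr rfl fun j hj => ?_
      rw [hcast j hj]
      ring
    have hsum : ∑ j ∈ Finset.range (q / 2), ((q:ℝ) - 2 * j - 1) * κ j = 2 * q := by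
      simp only [hκ, hc]
      rw [← key]
    rw [this, hsum]
  -- assemble
  have hmid : ∑ j ∈ Finset.range (q / 2), of (T j) -
      ∑ j ∈ Finset.range (q / 2), of ((Zj j).constMul ((q - 2 * j - 1 : ℕ) : ℝ) (isAlgebraic_nat _)) ∈
        relations := by
    rw [← Finset.sum_sub_distrib]
    refine AddSubgroup.sum_mem _ fun j hj => ?_
    have := relations.add_mem (h2 j hj) (h3 j)
    convert this using 1
    abel
  have := relations.sub_mem (relations.add_mem h1 hmid) h4
  convert this using 1
  abel


/-- Registered helper statement of this file (for the `--supports` match): `0 < θ_j < π`.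
[folklore] -/
theorem eulerTerms_theta_mem : ∀ (q j : ℕ), 0 < q → 2 * j + 1 < q → Real.pi * (2 * j + 1) / q ∈ Set.Ioo 0 Real.pi :=
  fun _ j hq hj => theta_mem_Ioo hq j hj

end Summit.KontsevichZagierPeriods.KontsevichZagierPeriods.BetaCancellationLine
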